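/-
Copyright: b2b-lace packet (LEAN TYPING SEAT 1, gen 41).  [FvdH17] §5.1 "Elements of the bounds" / App. B row
`(Ā^ι)_{2,2}`: the ENTRY INEQUALITY for `(Ā^ι)_{2,2} = sup_w Σ_x Σ_κ p τ_p(x − e_κ) τ_p(w − x)` (the open
simple bubble with one extra SRW step) through the landed Fourier cell `(D ⋆ τ_p^{⋆2})(w) ≤ Γ̄₂² K_{2,1}(w)`
and `K_{2,1}(w) ≤ K_{2,1}(0)`.  Proofs only; no named fact; no numeral; no dimension.
-/
import Literature.Probability.FitznerVanDerHofstad2017.NobleElementsClosedFormsRows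
import Literature.Probability.FitznerVanDerHofstad2017.NonRepulsiveDiagramBounds
import Literature.Probability.FitznerVanDerHofstad2017.SrwIntegralSupZero
import Literature.Probability.FitznerVanDerHofstad2017.NobleBlocksCov
import HarnessLib

/-!
# [FvdH17] §5.1 / App. B: the entry `(Ā^ι)_{2,2}` — the simple open bubble with one SRW step

Reproduction module (build `lace`, LEAN-IN-TREE RULE) in the package of
R. Fitzner, R. van der Hofstad, *Mean-field behavior for nearest-neighbor percolation in `d > 10`*,
Electron. J. Probab. **22** (2017) no. 43 [FvdH17] (arXiv:1506.07977v2): §5.1 "Elements of the bounds" (p. 49),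
App. B Table "definition of `Ā^{ι,a,b}(0,v,x,y)`", row `(2,2)` (p. 78); and of
R. Fitzner, R. van der Hofstad, *Generalized approach to the non-backtracking lace expansion*,
Probab. Theory Relat. Fields **169** (2017) [NoBLE17] (arXiv:1506.07969): §5.3.1 "Simple diagrams", (5.26) and
the bound `(D^{⋆m} ⋆ τ_p^{⋆n})(x) ≤ Γ̄₂ⁿ K_{n,m}(x)` (pp. 1093–1094), with `sup_x K_{n,l}(x) = K_{n,l}(0)` ((3.34),
(3.36) p. 1071).

The tree's closed form of the entry (`NobleElementsClosedFormsRows.matAbarIota_two_two`) is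
`(Ā^ι)_{2,2} = sup_w Σ_x Σ_κ p · τ_{≥0}(x − e_κ) · τ_{≥0}(w − x)` for any letter table; at the percolation
instance `Letters.perc d p` (`p = ofReal p`, `τ_{≥0} = ofReal τ_p`, `perc_p`, `perc_tau_ge`, `tauGe_zero_eq_tau`)
the inner double sum is, in `ℝ`, `p · Σ_κ (τ_p ⋆ τ_p)(w − e_κ) = 2d p · (D ⋆ τ_p^{⋆2})(w)` (shift
`x ↦ x + e_κ`; `srwStep_latticeConv_eq_sum`, `zdGraph_adj_iff_stepVec`), whence by the LANDED simple-diagram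
cell `srwConvTau_le_nobleSup2_pow_mul_srwK` (`n = 2`, `m = 1`, needs `2·2+1 ≤ d`) and `srwK_le_srwK_zero`:

* `perc_abarIota22_inner_eq_ofReal` — the inner sum in `ℝ≥0∞` equals `ofReal (2d p (D ⋆ τ_p^{⋆2})(w))`;
* `perc_matAbarIota_two_two_le_ofReal_sup2 : matAbarIota (Letters.perc d p) 2 2 ≤ ofReal (2d p · Γ̄₂² · K_{2,1}(0))`
  (`Γ̄₂ = nobleSup2 d p`; `5 ≤ d`, `p < p_c`);
* **`perc_matAbarIota_two_two_le_ofReal`** — the PRINTED form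
  `matAbarIota (Letters.perc d p) 2 2 ≤ ofReal (2d p · (((2d−2)/(2d−1)) Γ₂)² · K_{2,1}(0))` under `nobleF2 d p ≤ Γ₂`
  (`nobleSup2_le_of_nobleF2_le`), and `perc_matAbarIota_two_two_le_ofReal_printed` with `2d p ≤ (2d/(2d−1)) Γ₁`
  under `(2d−1) p ≤ Γ₁` (`two_d_mul_le_of_le`) — the notebook's `SB` cell `(2d z) Γ̄₂² K_{2,1}(0)` of this entry.

Any `d ≥ 5`, `p < p_c(ℤ^d)`; nothing is evaluated; no named fact; all theorems kernel-checked modulo the standard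
axioms.  The identification with the notebook numerals is NOT part of this module.

[cite: FitznerVanDerHofstad2017, §5.1 (arXiv:1506.07977v2 p. 49); App. B Table Ā^{ι,a,b} row (2,2) (p. 78); (6.5) (p. 58)]
[cite: FitznerVanDerHofstad2016NoBLE, §5.3.1 (5.26) and the display before it (PTRF 169 (2017) pp. 1093–1094); (3.34), (3.36) (p. 1071); (2.6)]
-/

noncomputable section

namespace Literature.Probability.FitznerVanDerHofstad2017

open MeasureTheory Finset
open scoped BigOperators ENNReal
open Literature.Probability.LatticeModels Literature.Probability.Percolation
open Literature.Barriers.CriticalPhenomena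
open Literature.Barriers.CriticalPhenomena.SpreadOutIsing (latticeConv convPow latticeConv_comm convPow_one_eq)
open Literature.Probability.FitznerVanDerHofstad2017.NobleBlocks

variable {d : ℕ}

/-! ## A. Real-side identities: the shift and the neighbour sum -/

/-- `Σ_x τ_p(x − e) τ_p(w − x) = (τ_p ⋆ τ_p)(w − e) = τ_p^{⋆2}(w − e)` (shift `x ↦ x + e`).
[cite: FitznerVanDerHofstad2016NoBLE, (1.2)–(1.3) (lattice convolution); §5.3.1 (p. 1093)] -/
theorem tsum_tau_shift_mul_tau_eq_convPow_two (p : unitInterval) (e w : Site d) :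
    ∑' x, tau d p 0 (x - e) * tau d p 0 (w - x) = convPow (tau d p 0) 2 (w - e) := by
  rw [show convPow (tau d p 0) 2 = latticeConv (convPow (tau d p 0) 1) (tau d p 0) from rfl, convPow_one_eq]
  show _ = ∑' y, tau d p 0 y * tau d p 0 (w - e - y)
  rw [← (Equiv.addRight e).tsum_eq fun x => tau d p 0 (x - e) * tau d p 0 (w - x)]
  exact tsum_congr fun y => by simp only [Equiv.coe_addRight, add_sub_cancel_right, sub_sub, add_comm e y]

/-- `Σ_κ g(w − e_κ) = 2d · (D ⋆ g)(w)` (`D = srwStep d`, the `2d` unit steps `e_κ`). `1 ≤ d`.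
[cite: FitznerVanDerHofstad2016NoBLE, (1.1) (D(x) = 𝟙{|x| = 1}/(2d))] -/
theorem sum_stepVec_eq_two_d_mul_latticeConv_srwStep (hd : 1 ≤ d) (g : Site d → ℝ) (w : Site d) :
    ∑ κ : Fin d × Bool, g (w - stepVec κ) = 2 * d * latticeConv (srwStep d) g w := by
  have hne : (2 * (d : ℝ)) ≠ 0 := by
    have h1 : (1 : ℝ) ≤ d := by exact_mod_cast hd
    positivity
  have hset : (zdGraph d).neighborFinset 0 = unitVecs d := by
    ext v
    rw [SimpleGraph.mem_neighborFinset, zdGraph_adj_iff_stepVec, mem_unitVecs_iff]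
    simp only [zero_add]
  rw [srwStep_latticeConv_eq_sum, hset, sum_unitVecs, ← mul_assoc, mul_one_div_cancel hne, one_mul]

/-- Summability of the shifted bubble summand `x ↦ τ_p(x − e) τ_p(w − x)` for `p < p_c` (`τ_p` summable,
`summable_tau_of_lt_criticalProb`; `2 ≤ d`). [cite: FitznerVanDerHofstad2016NoBLE, §5.3.1 (p. 1093)] -/
theorem summable_tau_shift_mul_tau (hd : 2 ≤ d) (p : unitInterval) (hp : p < criticalProbI d) (e w : Site d) :
    Summable fun x => tau d p 0 (x - e) * tau d p 0 (w - x) := by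
  have hp' : (p : ℝ) < criticalProb (zdGraph d) (0 : Site d) := hp
  have hs : Summable fun x => tau d p 0 x := summable_tau_of_lt_criticalProb hd p hp'
  exact summable_latticeConv_inner ((Equiv.subRight e).summable_iff.2 hs) hs (fun x => tau_nonneg p 0 _)
    (fun x => tau_nonneg p 0 x) w

/-- The real inner sum of the entry: `Σ_x Σ_κ p τ_p(x − e_κ) τ_p(w − x) = 2d p · (D ⋆ τ_p^{⋆2})(w)`
(`p < p_c`: `τ_p` summable; `2 ≤ d`), with the summability of `x ↦ Σ_κ p τ_p(x − e_κ) τ_p(w − x)`.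
[cite: FitznerVanDerHofstad2016NoBLE, §5.3.1 (p. 1093)] [cite: FitznerVanDerHofstad2017, App. B row (2,2) (arXiv:1506.07977v2 p. 78)] -/
theorem summable_abarIota22_summand (hd : 2 ≤ d) (p : unitInterval) (hp : p < criticalProbI d) (w : Site d) :
    Summable fun x => ∑ κ : Fin d × Bool, (p : ℝ) * tau d p 0 (x - stepVec κ) * tau d p 0 (w - x) := by
  refine summable_sum fun κ _ => ?_
  have h1 := summable_tau_shift_mul_tau hd p hp (stepVec κ) w
  simpa only [mul_assoc] using h1.mul_left (p : ℝ)

/-- `Σ_x Σ_κ p τ_p(x − e_κ) τ_p(w − x) = 2d p · (D^{⋆1} ⋆ τ_p^{⋆2})(w)`. `2 ≤ d`, `p < p_c`.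
[cite: FitznerVanDerHofstad2016NoBLE, §5.3.1 (p. 1093)] [cite: FitznerVanDerHofstad2017, App. B row (2,2) (arXiv:1506.07977v2 p. 78)] -/
theorem tsum_abarIota22_summand_eq (hd : 2 ≤ d) (p : unitInterval) (hp : p < criticalProbI d) (w : Site d) :
    ∑' x, ∑ κ : Fin d × Bool, (p : ℝ) * tau d p 0 (x - stepVec κ) * tau d p 0 (w - x) =
      2 * d * (p : ℝ) * latticeConv (convPow (srwStep d) 1) (convPow (tau d p 0) 2) w := by
  have h1 : ∀ κ : Fin d × Bool, Summable fun x => (p : ℝ) * tau d p 0 (x - stepVec κ) * tau d p 0 (w - x) :=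
    fun κ => by
      have h := summable_tau_shift_mul_tau hd p hp (stepVec κ) w
      simpa only [mul_assoc] using h.mul_left (p : ℝ)
  rw [Summable.tsum_finsetSum fun κ _ => h1 κ]
  simp_rw [mul_assoc, tsum_mul_left, tsum_tau_shift_mul_tau_eq_convPow_two]
  rw [← Finset.mul_sum, sum_stepVec_eq_two_d_mul_latticeConv_srwStep (by omega), convPow_one_eq]
  ring

/-! ## B. The entry `(Ā^ι)_{2,2}` at the percolation instance -/

/-- The inner double sum of `(Ā^ι)_{2,2}` at `Letters.perc d p`, in `ℝ≥0∞`, is `ofReal (2d p · (D ⋆ τ_p^{⋆2})(w))`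
(`perc_p`, `perc_tau_ge`, `tauGe_zero_eq_tau`, `ENNReal.ofReal_tsum_of_nonneg`). `2 ≤ d`, `p < p_c`.
[cite: FitznerVanDerHofstad2017, App. B Table Ā^{ι,a,b} row (2,2) (arXiv:1506.07977v2 p. 78); §5.1 (p. 49)]
[cite: FitznerVanDerHofstad2016NoBLE, §5.3.1 (p. 1093)] -/
theorem perc_abarIota22_inner_eq_ofReal (hd : 2 ≤ d) (p : unitInterval) (hp : p < criticalProbI d) (w : Site d) :
    ∑' x, ∑ κ : Fin d × Bool, (Letters.perc d p).p * (Letters.perc d p).tau (.ge 0) (x - stepVec κ) *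
        (Letters.perc d p).tau (.ge 0) (w - x) =
      ENNReal.ofReal (2 * d * (p : ℝ) * latticeConv (convPow (srwStep d) 1) (convPow (tau d p 0) 2) w) := by
  have hnn : ∀ (x : Site d) (κ : Fin d × Bool), 0 ≤ (p : ℝ) * tau d p 0 (x - stepVec κ) * tau d p 0 (w - x) :=
    fun x κ => mul_nonneg (mul_nonneg p.2.1 (tau_nonneg p 0 _)) (tau_nonneg p 0 _)
  have hterm : ∀ (x : Site d) (κ : Fin d × Bool),
      (Letters.perc d p).p * (Letters.perc d p).tau (.ge 0) (x - stepVec κ) * (Letters.perc d p).tau (.ge 0) (w - x) =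
        ENNReal.ofReal ((p : ℝ) * tau d p 0 (x - stepVec κ) * tau d p 0 (w - x)) := fun x κ => by
    rw [perc_p, perc_tau_ge, perc_tau_ge, tauGe_zero_eq_tau, tauGe_zero_eq_tau, ← ENNReal.ofReal_mul p.2.1,
      ← ENNReal.ofReal_mul (mul_nonneg p.2.1 (tau_nonneg p 0 _))]
  simp_rw [hterm]
  rw [← tsum_abarIota22_summand_eq hd p hp w, ENNReal.ofReal_tsum_of_nonneg
    (fun x => Finset.sum_nonneg fun κ _ => hnn x κ) (summable_abarIota22_summand hd p hp w)]
  exact tsum_congr fun x => (ENNReal.ofReal_sum_of_nonneg fun κ _ => hnn x κ).symm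

/-- **`(Ā^ι)_{2,2} ≤ 2d p · Γ̄₂² · K_{2,1}(0)`** at `Letters.perc d p` (`Γ̄₂ = nobleSup2 d p`): the closed form
`matAbarIota_two_two`, the inner sum `= ofReal (2d p (D ⋆ τ_p^{⋆2})(w))`, the LANDED simple-diagram cell
`srwConvTau_le_nobleSup2_pow_mul_srwK` (`(D ⋆ τ_p^{⋆2})(w) ≤ Γ̄₂² K_{2,1}(w)`, `2·2+1 ≤ d`) and
`srwK_le_srwK_zero` (`K_{2,1}(w) ≤ K_{2,1}(0)`), then `iSup_le`. `5 ≤ d`, `p < p_c`.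
[cite: FitznerVanDerHofstad2017, §5.1 "Elements of the bounds" (arXiv:1506.07977v2 p. 49); App. B row (2,2) (p. 78)]
[cite: FitznerVanDerHofstad2016NoBLE, §5.3.1 (5.26) and the display before it (pp. 1093–1094); (3.34), (3.36) (p. 1071)] -/
theorem perc_matAbarIota_two_two_le_ofReal_sup2 (hd : 5 ≤ d) (p : unitInterval) (hp : p < criticalProbI d) :
    matAbarIota (Letters.perc d p) 2 2 ≤ ENNReal.ofReal (2 * d * (p : ℝ) * (nobleSup2 d p ^ 2 * srwK d 2 1 0)) := by
  have h2dp : 0 ≤ 2 * d * (p : ℝ) := by have := p.2.1; positivity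
  rw [matAbarIota_two_two]
  refine iSup_le fun w => ?_
  rw [perc_abarIota22_inner_eq_ofReal (by omega) p hp w]
  refine ENNReal.ofReal_le_ofReal (mul_le_mul_of_nonneg_left ?_ h2dp)
  exact (srwConvTau_le_nobleSup2_pow_mul_srwK (n := 2) (by omega) (by omega) p hp 1 w).trans
    (mul_le_mul_of_nonneg_left (srwK_le_srwK_zero (n := 2) (by omega) 1 w) (pow_nonneg (nobleSup2_nonneg' p) 2))

/-- **The PRINTED entry inequality for `(Ā^ι)_{2,2}`**:
`matAbarIota (Letters.perc d p) 2 2 ≤ ofReal (2d p · (((2d−2)/(2d−1)) Γ₂)² · K_{2,1}(0))` under `nobleF2 d p ≤ Γ₂`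
(`Γ̄₂ ≤ ((2d−2)/(2d−1)) Γ₂`, `nobleSup2_le_of_nobleF2_le`) — the notebook's cell `(2d z) Γ̄₂² K_{2,1}(0)` of this
entry read at `z = p`. `5 ≤ d`, `p < p_c`.
[cite: FitznerVanDerHofstad2017, §5.1 "Elements of the bounds" (arXiv:1506.07977v2 p. 49); App. B row (2,2) (p. 78); notebook Percolation.nb]
[cite: FitznerVanDerHofstad2016NoBLE, §5.3.1 (5.26) (p. 1094); (2.6)] -/
theorem perc_matAbarIota_two_two_le_ofReal (hd : 5 ≤ d) (p : unitInterval) (hp : p < criticalProbI d) {Γ₂ : ℝ}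
    (hΓ2 : nobleF2 d p ≤ Γ₂) :
    matAbarIota (Letters.perc d p) 2 2 ≤
      ENNReal.ofReal (2 * d * (p : ℝ) * (((2 * d - 2) / (2 * d - 1) * Γ₂) ^ 2 * srwK d 2 1 0)) := by
  have h2dp : 0 ≤ 2 * d * (p : ℝ) := by have := p.2.1; positivity
  exact (perc_matAbarIota_two_two_le_ofReal_sup2 hd p hp).trans (ENNReal.ofReal_le_ofReal
    (mul_le_mul_of_nonneg_left (mul_le_mul_of_nonneg_right
      (pow_le_pow_left₀ (nobleSup2_nonneg' p) (nobleSup2_le_of_nobleF2_le (by omega) p hΓ2) 2) (srwK_nonneg 2 1 0))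
      h2dp))

/-- **The PRINTED entry inequality for `(Ā^ι)_{2,2}`, both constants**:
`matAbarIota (Letters.perc d p) 2 2 ≤ ofReal ((2d/(2d−1)) Γ₁ · (((2d−2)/(2d−1)) Γ₂)² · K_{2,1}(0))` under
`(2d−1) p ≤ Γ₁` (`2d p ≤ (2d/(2d−1)) Γ₁`, `two_d_mul_le_of_le`) and `nobleF2 d p ≤ Γ₂`. `5 ≤ d`, `p < p_c`.
[cite: FitznerVanDerHofstad2017, §5.1 "Elements of the bounds" (arXiv:1506.07977v2 p. 49); App. B row (2,2) (p. 78)]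
[cite: FitznerVanDerHofstad2016NoBLE, §5.3.1 (5.13), (5.26) (pp. 1092–1094); (2.6)] -/
theorem perc_matAbarIota_two_two_le_ofReal_printed (hd : 5 ≤ d) (p : unitInterval) (hp : p < criticalProbI d)
    {Γ₁ Γ₂ : ℝ} (hΓ1 : (2 * d - 1) * (p : ℝ) ≤ Γ₁) (hΓ2 : nobleF2 d p ≤ Γ₂) :
    matAbarIota (Letters.perc d p) 2 2 ≤
      ENNReal.ofReal (2 * d / (2 * d - 1) * Γ₁ * (((2 * d - 2) / (2 * d - 1) * Γ₂) ^ 2 * srwK d 2 1 0)) :=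
  (perc_matAbarIota_two_two_le_ofReal hd p hp hΓ2).trans (ENNReal.ofReal_le_ofReal
    (mul_le_mul_of_nonneg_right (two_d_mul_le_of_le (by omega) p hΓ1) (mul_nonneg (sq_nonneg _) (srwK_nonneg 2 1 0))))

end Literature.Probability.FitznerVanDerHofstad2017
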